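import Summits.Ventures.CertifiedQuantumChemistry.Rows.SingletTempleRows
import Summits.Ventures.CertifiedQuantumChemistry.Rows.SingletUpperSpinBound
import HarnessLib

/-!
# Ventures/CertifiedQuantumChemistry — Rows/SingletTempleSpinRows.lean: TEMPLE'S INEQUALITY ON THE SINGLET
# SUBSPACE `K` FROM A SPIN-CONTAMINATED SECTOR TRIAL — certified SINGLET lower rows `E₀(Ĥ_F; N = 2n, S = 0)`
# from a `K`-gap leg, ONE sector vector `ψ` and a bound `s ≥ ‖Ŝ_+ψ‖²`

HONEST FRAMING (verbatim): certified bounds for a stated model Hamiltonian in a stated basis; not a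
claim about the real molecule or material beyond that model.

Typer chem-type-09 (LADDER-CHEM I-TYPE slot 09, custody of `Rows/Temple*`), for the Temple row of door
M1-OS STEP-2 (chem-lead A28 (3), 2026-08-27): the trial whose moments certnum encloses is the `S_z` EXPORT of
an `SU(2)`-symmetric MPS — a vector of the `(n, n)` sector that is NOT exactly in `K = sector ∩ ker Ŝ_+`
(Clebsch–Gordan roundings), so the landed (T) kernel `Rows/SingletTempleRows.lean` (`SingletTempleCertificate`:
the witness is IN `K`; its own CAVEAT) cannot take it. This is the spin-contaminated sibling, in the manner of
`Rows/SingletUpperSpinBound.lean` (singlet UPPER row from a contaminated trial): the contamination enters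
through ONE extra number `s ≥ ‖Ŝ_+ψ‖²` (`= ⟨ψ, Ŝ²ψ⟩` on `S_z = 0`).

THE INEQUALITY (everything PROVED, 0 sorry). `H = Ĥ(F)` (symmetric `F`), `E = F.singletEnergy n`, a gap leg
on `K` at `β` (`SingletGapCertificate F n β`, or the codimension-one certificate), `ψ` ANY vector of the
`(n, n)` sector, `N = ⟨ψ,ψ⟩`, `A = Re⟨ψ,Hψ⟩`, `M = Re⟨ψ,H²ψ⟩`, `s ≥ ‖Ŝ_+ψ‖²`:
  (★)  `0 ≤ M − (E + β)·A + E·β·N + (s/8)·(β − E)²`            (`singletEnergy_temple_spin_ineq`);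
for `s = 0` this is Temple's `⟨ψ, (H − E)(H − β)ψ⟩ ≥ 0` (Reed–Simon IV Thm XIII.5, tree `templeInequality_holds`).
PROOF: `ψ = Pψ + (ψ − Pψ)`, `P = P_{S=0}` (`SymmetryProjection.singletProj`; `[H, Ŝ²] = 0 ⇒ [P, H] = 0 =
[P, H²]`, so the three moments split); on `Pψ ∈ K` the Temple form is `≥ 0` (§1); on the remainder it equals
`‖(H − (E+β)/2)(ψ − Pψ)‖² − ((β − E)/2)²‖ψ − Pψ‖² ≥ −((β − E)²/4)‖ψ − Pψ‖²`, and `2‖ψ − Pψ‖² ≤ ‖Ŝ_+ψ‖² ≤ s`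
(`two_mul_norm_sub_singletProj_le`: the non-singlet part lies in multiplets with `S(S+1) ≥ 2`).
THE ROW (§3). `P(e) := M − (e + β)A + eβN + (s/8)(β − e)²` is a CONVEX quadratic with `P(E) ≥ 0`; given ANY
a-priori singlet lower row `L ≤ E` (`SingletLowerRow F n L`, e.g. `LowerRow.singlet` of the sector's DQG leg),
the two exact inequalities `P(L) < 0`, `P(lo) ≤ 0` exclude `E ∈ [L, lo)` (a convex function lies below its
chord) ⇒ `SingletLowerRow F n lo`. For `s = 0` the checks say `A < βN ∧ lo(βN − A) ≤ βA − M` (Temple's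
quotient); for `s > 0` the correction at the claim point is `(s/8)(β − lo)²`.

## Contents
* §1 `temple_form_nonneg_of_singletGap` (Temple's form `≥ 0` on `K`); §2 `singletEnergy_temple_spin_ineq` (★);
* §3 `convexQuadratic_neg_of_endpoints` (chord argument, arithmetic), `singletLowerRow_of_temple_spin{,_codimOne}`
  (exact moments ⇒ row); §4 the claim-node SHAPE `SingletTempleCertificateSpin F n L lo β` (ONE `def`, nothing
  asserted) + soundness `singletLowerRow_of_templeSpinCertificate{,_of_lowerRow}`;
* THE CERTNUM PLUG (interval SHIFTED moments = the record fields of `TempleMoments.Cert` + ONE more enclosure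
  `‖Ŝ_+ψ‖² ≤ shi` + two decidable rational inequalities ⇒ the row) is the sequel
  `Rows/SingletTempleSpinIntervalRows.lean`.
What is NOT here: how the vector / enclosures are produced (certnum, reader-side), the gap leg (chem-type-02's
supplier + `Rows/SingletGapCertificateCodimOne.lean`), any number or claim node; nothing of the imported files is
restated. References: Reed–Simon IV Thm XIII.5 [cite: ReedSimonIV1978, Thm XIII.5]; Weinstein–Stenger (1972)
Ch. 5 §9 eq. (2), p. 104 [cite: WeinsteinStenger1972, Ch. 5 §9 eq. (2), p. 104]; Moore (1979) §2.2 (2.19)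
[cite: Moore1979, §2.2 eq. (2.19)]; Löwdin (1955) spin projector as cited in `Rows/SingletUpperSpinBound.lean`.
The `s`-correction is ours (elementary). [folklore]
-/

noncomputable section

namespace Summit.Ventures.CertifiedQuantumChemistry

open Matrix Finset
open Literature.MathematicalPhysics.QuantumLattice Literature.MathematicalPhysics.QuantumChemistry
open Literature.MathematicalPhysics.QuantumLattice.EigenvalueContinuation
open Literature.MathematicalPhysics.QuantumLattice.SymmetryProjection (singletProj)
open scoped ComplexOrder

variable {k : ℕ}

/-! ## §0 Two splitting identities along a Hermitian idempotent (private re-proofs, cf.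
`Rows/SingletUpperSpinBound.lean`) -/

/-- `⟨ψ,ψ⟩ = ⟨Pψ,Pψ⟩ + ⟨ψ−Pψ, ψ−Pψ⟩` for a Hermitian idempotent `P`. [folklore] -/
private theorem norm_split' {ι : Type*} [Fintype ι] [DecidableEq ι] {P : Matrix ι ι ℂ} (hP : Pᴴ = P)
    (hPP : P * P = P) (ψ : ι → ℂ) :
    star ψ ⬝ᵥ ψ = star (P *ᵥ ψ) ⬝ᵥ (P *ᵥ ψ) + star (ψ - P *ᵥ ψ) ⬝ᵥ (ψ - P *ᵥ ψ) := by
  have h1 : star (P *ᵥ ψ) ⬝ᵥ (P *ᵥ ψ) = star ψ ⬝ᵥ (P *ᵥ ψ) := by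
    rw [star_mulVec, hP, ← dotProduct_mulVec, mulVec_mulVec, hPP]
  have h2 : star (P *ᵥ ψ) ⬝ᵥ ψ = star ψ ⬝ᵥ (P *ᵥ ψ) := by
    rw [star_mulVec, hP, ← dotProduct_mulVec]
  rw [star_sub, sub_dotProduct, dotProduct_sub, dotProduct_sub, h1, h2]
  ring

/-- `⟨ψ,Aψ⟩ = ⟨Pψ, A Pψ⟩ + ⟨ψ−Pψ, A(ψ−Pψ)⟩` for a Hermitian idempotent `P` commuting with `A`. [folklore] -/
private theorem expect_split' {ι : Type*} [Fintype ι] [DecidableEq ι] {P A : Matrix ι ι ℂ} (hP : Pᴴ = P)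
    (hPP : P * P = P) (hPA : Commute P A) (ψ : ι → ℂ) :
    star ψ ⬝ᵥ (A *ᵥ ψ) =
      star (P *ᵥ ψ) ⬝ᵥ (A *ᵥ (P *ᵥ ψ)) + star (ψ - P *ᵥ ψ) ⬝ᵥ (A *ᵥ (ψ - P *ᵥ ψ)) := by
  have hAP : A * P = P * A := hPA.eq.symm
  have h1 : star (P *ᵥ ψ) ⬝ᵥ (A *ᵥ (P *ᵥ ψ)) = star ψ ⬝ᵥ ((A * P) *ᵥ ψ) := by
    rw [star_mulVec, hP, ← dotProduct_mulVec, mulVec_mulVec, mulVec_mulVec, ← hAP, Matrix.mul_assoc, hPP]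
  have h2 : star (P *ᵥ ψ) ⬝ᵥ (A *ᵥ ψ) = star ψ ⬝ᵥ ((A * P) *ᵥ ψ) := by
    rw [star_mulVec, hP, ← dotProduct_mulVec, mulVec_mulVec, hAP]
  have h3 : star ψ ⬝ᵥ (A *ᵥ (P *ᵥ ψ)) = star ψ ⬝ᵥ ((A * P) *ᵥ ψ) := by rw [mulVec_mulVec]
  rw [star_sub, sub_dotProduct, mulVec_sub, dotProduct_sub, dotProduct_sub, h1, h2, h3]
  ring

/-! ## §1 Temple's quadratic form is nonnegative on `K` -/

/-- **TEMPLE'S FORM ON `K`.** For a symmetric model, a spectral gap leg on the singlet subspace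
`SingletGapCertificate F n β` and ANY `x ∈ K = singletSector k n` (any norm), with
`E = E₀(Ĥ_F; N = 2n, S = 0)`:  `0 ≤ Re⟨x, Ĥ²x⟩ − (E + β)·Re⟨x, Ĥx⟩ + E·β·⟨x, x⟩`, i.e.
`⟨x, (Ĥ − E)(Ĥ − β)x⟩ ≥ 0` — the operator inequality behind Temple's theorem (Reed–Simon IV Thm XIII.5:
«the proof `(H − μ₁)(H − μ̌₂) ≥ 0`»). Three elementary cases: `β ≤ E` (then it is
`‖(Ĥ − E)x‖² + (E − β)(Re⟨x,Ĥx⟩ − E⟨x,x⟩)`, both terms `≥ 0` by the variational principle on `K`);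
`E < β` and `Re⟨x,Ĥx⟩ < β⟨x,x⟩` (Temple's inequality `templeInequality_holds` for the unit multiple of `x`,
denominators cleared); `E < β` and `Re⟨x,Ĥx⟩ ≥ β⟨x,x⟩` (then it is `‖(Ĥ − β)x‖² + (β − E)(Re⟨x,Ĥx⟩ − β⟨x,x⟩)`).
[cite: ReedSimonIV1978, Thm XIII.5] -/
theorem temple_form_nonneg_of_singletGap {F : Model k} (hF : F.IsSymmetric) {n : ℕ} {β : ℚ}
    (hG : SingletGapCertificate F n β) {x : Fock (Orb (Fin k))} (hx : x ∈ singletSector k n) :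
    0 ≤ (star x ⬝ᵥ (F.hamiltonian * F.hamiltonian) *ᵥ x).re
        - (F.singletEnergy n + ((β : ℚ) : ℝ)) * (star x ⬝ᵥ F.hamiltonian *ᵥ x).re
        + F.singletEnergy n * ((β : ℚ) : ℝ) * (star x ⬝ᵥ x).re := by
  set H := F.hamiltonian with hHdef
  have hH : H.IsHermitian := Model.hamiltonian_isHermitian hF
  set K : Submodule ℂ (Fock (Orb (Fin k))) := singletSector k n with hKdef
  set E : ℝ := F.singletEnergy n with hEdef
  set β' : ℝ := ((β : ℚ) : ℝ) with hβ'def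
  set N : ℝ := (star x ⬝ᵥ x).re with hNdef
  set A : ℝ := (star x ⬝ᵥ H *ᵥ x).re with hAdef
  set M : ℝ := (star x ⬝ᵥ (H * H) *ᵥ x).re with hMdef
  have hE : F.singletEnergy n = H.minEnergyOn K := rfl
  have hEE : E = H.minEnergyOn K := rfl
  -- the variational principle on `K`: `E·⟨x,x⟩ ≤ Re⟨x,Hx⟩`
  have hxE : E * N ≤ A := minEnergyOn_mul_le_re_rayleigh hH _ hx
  -- the residual identities `‖(H − τ)x‖² = M − 2τA + τ²N ≥ 0`
  have hres : ∀ τ : ℝ, 0 ≤ M - 2 * τ * A + τ ^ 2 * N := fun τ => by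
    have h := re_star_dotProduct_self_nonneg (H *ᵥ x - (τ : ℂ) • x)
    rwa [re_residual_self_eq_moments hH x τ] at h
  by_cases hβE : β' ≤ E
  · -- `q = ‖(H − E)x‖² + (E − β)(A − E N)`
    have hprod : 0 ≤ (E - β') * (A - E * N) := mul_nonneg (sub_nonneg.2 hβE) (sub_nonneg.2 hxE)
    nlinarith [hres E, hprod]
  push Not at hβE
  by_cases hA : A < β' * N
  · -- Temple's inequality for the unit multiple of `x`
    have hx0 : x ≠ 0 := by
      intro h0
      have hA0 : A = 0 := by rw [hAdef, h0, mulVec_zero, dotProduct_zero, Complex.zero_re]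
      have hN0 : N = 0 := by rw [hNdef, h0, dotProduct_zero, Complex.zero_re]
      rw [hA0, hN0, mul_zero] at hA
      exact lt_irrefl _ hA
    obtain ⟨c, hc, hcc, h1⟩ := exists_normalize hx0
    have hcc' : c * c * N = 1 := hcc
    have hct : 0 < c * c := mul_pos hc hc
    have hKH : ∀ v ∈ K, H *ᵥ v ∈ K := fun v hv => F.hamiltonian_mulVec_mem_singletSector hv
    have hgap : ∀ (e : ℝ) (v : Fock (Orb (Fin k))), v ∈ K → v ≠ 0 →
        H *ᵥ v = (e : ℂ) • v → e ≠ H.minEnergyOn K → β' ≤ e :=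
      fun e v hv hv0 hHv hne => hG e v hv hv0 hHv (hE ▸ hne)
    have hρ' : (star ((c : ℂ) • x) ⬝ᵥ H *ᵥ ((c : ℂ) • x)).re = c * c * A :=
      re_star_smul_dotProduct_mulVec_smul _ c x
    have hm' : (star ((c : ℂ) • x) ⬝ᵥ (H * H) *ᵥ ((c : ℂ) • x)).re = c * c * M :=
      re_star_smul_dotProduct_mulVec_smul _ c x
    have hlt' : c * c * A < β' := by
      have h := mul_lt_mul_of_pos_left hA hct
      calc c * c * A < c * c * (β' * N) := h
        _ = β' * (c * c * N) := by ring
        _ = β' := by rw [hcc', mul_one]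
    have hT := templeInequality_holds H hH K hKH β' hgap ((c : ℂ) • x) (K.smul_mem _ hx) h1
      (by rw [hρ']; exact hlt')
    rw [hρ', hm', ← hEE] at hT
    have hpos : 0 < β' - c * c * A := sub_pos.2 hlt'
    have h2 : c * c * A - E ≤ (c * c * M - (c * c * A) ^ 2) / (β' - c * c * A) := by linarith
    rw [le_div_iff₀ hpos] at h2
    -- `c² · q = (c²M − (c²A)²) − (c²A − E)(β − c²A)` because `c²N = 1`
    have key : c * c * (M - (E + β') * A + E * β' * N) =
        (c * c * M - (c * c * A) ^ 2) - (c * c * A - E) * (β' - c * c * A) := by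
      linear_combination (E * β') * hcc'
    have hq : 0 ≤ c * c * (M - (E + β') * A + E * β' * N) := by rw [key]; linarith
    by_contra hneg
    push Not at hneg
    have := mul_neg_of_pos_of_neg hct hneg
    linarith
  · -- `q = ‖(H − β)x‖² + (β − E)(A − β N)`
    push Not at hA
    have hprod : 0 ≤ (β' - E) * (A - β' * N) := mul_nonneg (sub_nonneg.2 hβE.le) (sub_nonneg.2 hA)
    nlinarith [hres β', hprod]

/-! ## §2 The contamination-tolerant Temple inequality (★) -/

/-- **(★) TEMPLE ON `K` WITH A SPIN-CONTAMINATED TRIAL.** For a symmetric model `F`, a spectral gap leg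
on the singlet subspace `SingletGapCertificate F n β`, ANY vector `ψ` of the `(n, n)` sector and any real
`s ≥ ‖Ŝ_+ψ‖²`, with `E = E₀(Ĥ_F; N = 2n, S = 0)`:
`0 ≤ Re⟨ψ, Ĥ²ψ⟩ − (E + β)·Re⟨ψ, Ĥψ⟩ + E·β·⟨ψ,ψ⟩ + (s/8)·(β − E)²`.
Proof: `ψ = Pψ + (ψ − Pψ)`, `P = P_{S=0}` (`singletProj`, commutes with `Ĥ` and `Ĥ²` since `[Ĥ, Ŝ²] = 0`);
§1 on `Pψ ∈ K`; `‖(Ĥ − (E+β)/2)(ψ − Pψ)‖² ≥ 0` on the remainder; `2‖ψ − Pψ‖² ≤ ‖Ŝ_+ψ‖² ≤ s`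
(`two_mul_norm_sub_singletProj_le`). For `s = 0` it is Temple's `(Ĥ − E)(Ĥ − β) ≥ 0`.
[cite: ReedSimonIV1978, Thm XIII.5] -/
theorem singletEnergy_temple_spin_ineq {F : Model k} (hF : F.IsSymmetric) {n : ℕ} {β : ℚ}
    (hG : SingletGapCertificate F n β) {ψ : Fock (Orb (Fin k))} (hψ : IsInSector n n ψ) {s : ℝ}
    (hs : (star (spinPlus *ᵥ ψ) ⬝ᵥ (spinPlus *ᵥ ψ)).re ≤ s) :
    0 ≤ (star ψ ⬝ᵥ (F.hamiltonian * F.hamiltonian) *ᵥ ψ).re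
        - (F.singletEnergy n + ((β : ℚ) : ℝ)) * (star ψ ⬝ᵥ F.hamiltonian *ᵥ ψ).re
        + F.singletEnergy n * ((β : ℚ) : ℝ) * (star ψ ⬝ᵥ ψ).re
        + s / 8 * (((β : ℚ) : ℝ) - F.singletEnergy n) ^ 2 := by
  classical
  set H := F.hamiltonian with hHdef
  have hH : H.IsHermitian := Model.hamiltonian_isHermitian hF
  set E : ℝ := F.singletEnergy n with hEdef
  set β' : ℝ := ((β : ℚ) : ℝ) with hβ'def
  set P : Matrix (Finset (Orb (Fin k))) (Finset (Orb (Fin k))) ℂ := singletProj with hPdef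
  have hPP : P * P = P := SymmetryProjection.singletProj_mul_self
  have hPh : Pᴴ = P := SymmetryProjection.singletProj_conjTranspose
  have hHS : Commute H spinSq := molecularHamiltonian_commute_spinSq _ _ _
  have hPH : Commute P H := singletProj_commute_of_commute_spinSq hHS (by rw [hH.eq]; exact hHS)
  have hPHH : Commute P (H * H) := hPH.mul_right hPH
  -- sector bookkeeping
  have hψV : ψ ∈ szSector (n + n) 0 := by
    have h := (mem_szSector_iff_isInSector n n ψ).2 hψ
    rwa [sub_self, zero_div] at h
  set ψ₀ := P *ᵥ ψ with hψ₀
  set ψ₁ := ψ - P *ᵥ ψ with hψ₁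
  have hψ₀V : ψ₀ ∈ szSector (n + n) 0 := singletProj_mulVec_mem_szSector hψV
  have hψ₀K : ψ₀ ∈ singletSector k n := by
    rw [mem_singletSector_iff, sub_self, zero_div]
    exact ⟨hψ₀V, (spin_mulVec_eq_zero_of_spinSq_mulVec_eq_zero
      (SymmetryProjection.spinSq_mulVec_singletProj_mulVec ψ)).1⟩
  -- the three splittings
  have hN : (star ψ ⬝ᵥ ψ).re = (star ψ₀ ⬝ᵥ ψ₀).re + (star ψ₁ ⬝ᵥ ψ₁).re := by
    rw [norm_split' hPh hPP ψ, Complex.add_re]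
  have hA : (star ψ ⬝ᵥ H *ᵥ ψ).re = (star ψ₀ ⬝ᵥ H *ᵥ ψ₀).re + (star ψ₁ ⬝ᵥ H *ᵥ ψ₁).re := by
    rw [expect_split' hPh hPP hPH ψ, Complex.add_re]
  have hM : (star ψ ⬝ᵥ (H * H) *ᵥ ψ).re =
      (star ψ₀ ⬝ᵥ (H * H) *ᵥ ψ₀).re + (star ψ₁ ⬝ᵥ (H * H) *ᵥ ψ₁).re := by
    rw [expect_split' hPh hPP hPHH ψ, Complex.add_re]
  -- the singlet part: Temple's form `≥ 0` (§1)
  have hq0 : 0 ≤ (star ψ₀ ⬝ᵥ (H * H) *ᵥ ψ₀).re - (E + β') * (star ψ₀ ⬝ᵥ H *ᵥ ψ₀).re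
      + E * β' * (star ψ₀ ⬝ᵥ ψ₀).re :=
    temple_form_nonneg_of_singletGap hF hG hψ₀K
  -- the remainder: `q(ψ₁) = ‖(H − (E+β)/2)ψ₁‖² − ((β − E)/2)²‖ψ₁‖²`
  have hq1 : -((β' - E) ^ 2 / 4 * (star ψ₁ ⬝ᵥ ψ₁).re) ≤
      (star ψ₁ ⬝ᵥ (H * H) *ᵥ ψ₁).re - (E + β') * (star ψ₁ ⬝ᵥ H *ᵥ ψ₁).re
        + E * β' * (star ψ₁ ⬝ᵥ ψ₁).re := by
    have h := re_star_dotProduct_self_nonneg (H *ᵥ ψ₁ - (((E + β') / 2 : ℝ) : ℂ) • ψ₁)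
    rw [re_residual_self_eq_moments hH ψ₁ ((E + β') / 2)] at h
    nlinarith [h]
  -- the contamination bound `2‖ψ₁‖² ≤ ‖Ŝ_+ψ‖² ≤ s`
  have hx : 2 * (star ψ₁ ⬝ᵥ ψ₁).re ≤ (star (spinPlus *ᵥ ψ) ⬝ᵥ (spinPlus *ᵥ ψ)).re :=
    two_mul_norm_sub_singletProj_le hψV
  have hN1 : (star ψ₁ ⬝ᵥ ψ₁).re ≤ s / 2 := by linarith
  have h4 : (β' - E) ^ 2 * (star ψ₁ ⬝ᵥ ψ₁).re ≤ (β' - E) ^ 2 * (s / 2) :=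
    mul_le_mul_of_nonneg_left hN1 (sq_nonneg _)
  rw [hN, hA, hM]
  nlinarith [hq0, hq1, h4]

/-- (★) under the codimension-one gap certificate on `K` (`SingletGapCertificateCodimOne F n β`, the
deflation producer's currency; downgrade `SingletGapCertificateCodimOne.singletGapCertificate`).
[cite: ReedSimonIV1978, Thm XIII.5] -/
theorem singletEnergy_temple_spin_ineq_codimOne {F : Model k} (hF : F.IsSymmetric) {n : ℕ} {β : ℚ}
    (hG : SingletGapCertificateCodimOne F n β) {ψ : Fock (Orb (Fin k))} (hψ : IsInSector n n ψ) {s : ℝ}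
    (hs : (star (spinPlus *ᵥ ψ) ⬝ᵥ (spinPlus *ᵥ ψ)).re ≤ s) :
    0 ≤ (star ψ ⬝ᵥ (F.hamiltonian * F.hamiltonian) *ᵥ ψ).re
        - (F.singletEnergy n + ((β : ℚ) : ℝ)) * (star ψ ⬝ᵥ F.hamiltonian *ᵥ ψ).re
        + F.singletEnergy n * ((β : ℚ) : ℝ) * (star ψ ⬝ᵥ ψ).re
        + s / 8 * (((β : ℚ) : ℝ) - F.singletEnergy n) ^ 2 :=
  singletEnergy_temple_spin_ineq hF (hG.singletGapCertificate hF) hψ hs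

/-! ## §3 The row: excluding `E ∈ [L, lo)` by two evaluations of the convex quadratic `P` -/

/-- **The chord argument** (pure arithmetic). A quadratic `P(e) = α e² + γ e + δ` with `α ≥ 0` is convex:
if `P(L) < 0` and `P(lo) ≤ 0` then `P(e) < 0` for every `e ∈ [L, lo)` — from the identity
`(d − u)·P(L) + u·P(lo) − d·P(e) = α·u·d·(d − u)` with `d = lo − L`, `u = e − L`. [folklore] -/
theorem convexQuadratic_neg_of_endpoints {α γ δ L lo e : ℝ} (hα : 0 ≤ α) (hLe : L ≤ e) (helo : e < lo)
    (hPL : α * L ^ 2 + γ * L + δ < 0) (hPlo : α * lo ^ 2 + γ * lo + δ ≤ 0) :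
    α * e ^ 2 + γ * e + δ < 0 := by
  set d := lo - L with hd
  set u := e - L with hu
  have hd0 : 0 < d := by rw [hd]; linarith
  have hu0 : 0 ≤ u := by rw [hu]; linarith
  have hdu : 0 < d - u := by rw [hd, hu]; linarith
  have hid : (d - u) * (α * L ^ 2 + γ * L + δ) + u * (α * lo ^ 2 + γ * lo + δ) -
      d * (α * e ^ 2 + γ * e + δ) = α * u * d * (d - u) := by
    rw [hd, hu]; ring
  have hrem : 0 ≤ α * u * d * (d - u) := mul_nonneg (mul_nonneg (mul_nonneg hα hu0) hd0.le) hdu.le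
  have h1 : (d - u) * (α * L ^ 2 + γ * L + δ) < 0 := mul_neg_of_pos_of_neg hdu hPL
  have h2 : u * (α * lo ^ 2 + γ * lo + δ) ≤ 0 := mul_nonpos_iff.2 (Or.inl ⟨hu0, hPlo⟩)
  by_contra hneg
  push Not at hneg
  have h3 : 0 ≤ d * (α * e ^ 2 + γ * e + δ) := mul_nonneg hd0.le hneg
  linarith

/-- **SINGLET TEMPLE LOWER ROW FROM A SPIN-CONTAMINATED SECTOR TRIAL** (exact moments). For a symmetric
model `F`: a gap leg on `K` at `β` (`SingletGapCertificate F n β`), ANY a-priori singlet lower row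
`SingletLowerRow F n L` (e.g. `LowerRow.singlet` of a sector leg), a claim `lo`, a vector `ψ` of the
`(n, n)` sector with `s ≥ ‖Ŝ_+ψ‖²`, and — writing `N = ⟨ψ,ψ⟩`, `A = Re⟨ψ,Ĥψ⟩`, `M = Re⟨ψ,Ĥ²ψ⟩`,
`P(e) = M − (e + β)A + eβN + (s/8)(β − e)²` — the two inequalities `P(L) < 0`, `P(lo) ≤ 0`. Then
`SingletLowerRow F n lo`, i.e. `lo ≤ E₀(Ĥ_F; N = 2n, S = 0)`: by (★) `P(E) ≥ 0`, while `P < 0` on `[L, lo)`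
(`convexQuadratic_neg_of_endpoints`) and `E ≥ L`. For `s = 0` (a witness in `K`) the hypotheses say
`A < βN` and `lo·(βN − A) ≤ βA − M`, i.e. this is `singletLowerRow_of_temple`.
[cite: ReedSimonIV1978, Thm XIII.5] -/
theorem singletLowerRow_of_temple_spin {F : Model k} (hF : F.IsSymmetric) {n : ℕ} {β L lo : ℚ}
    (hG : SingletGapCertificate F n β) (hL : SingletLowerRow F n L)
    {ψ : Fock (Orb (Fin k))} (hψ : IsInSector n n ψ) {s : ℝ}
    (hs : (star (spinPlus *ᵥ ψ) ⬝ᵥ (spinPlus *ᵥ ψ)).re ≤ s)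
    (hPL : (star ψ ⬝ᵥ (F.hamiltonian * F.hamiltonian) *ᵥ ψ).re
        - (((L : ℚ) : ℝ) + ((β : ℚ) : ℝ)) * (star ψ ⬝ᵥ F.hamiltonian *ᵥ ψ).re
        + ((L : ℚ) : ℝ) * ((β : ℚ) : ℝ) * (star ψ ⬝ᵥ ψ).re
        + s / 8 * (((β : ℚ) : ℝ) - ((L : ℚ) : ℝ)) ^ 2 < 0)
    (hPlo : (star ψ ⬝ᵥ (F.hamiltonian * F.hamiltonian) *ᵥ ψ).re
        - (((lo : ℚ) : ℝ) + ((β : ℚ) : ℝ)) * (star ψ ⬝ᵥ F.hamiltonian *ᵥ ψ).re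
        + ((lo : ℚ) : ℝ) * ((β : ℚ) : ℝ) * (star ψ ⬝ᵥ ψ).re
        + s / 8 * (((β : ℚ) : ℝ) - ((lo : ℚ) : ℝ)) ^ 2 ≤ 0) :
    SingletLowerRow F n lo := by
  refine ⟨hL.1, ?_⟩
  set E : ℝ := F.singletEnergy n with hEdef
  set β' : ℝ := ((β : ℚ) : ℝ) with hβ'def
  set L' : ℝ := ((L : ℚ) : ℝ) with hL'def
  set lo' : ℝ := ((lo : ℚ) : ℝ) with hlo'def
  set N : ℝ := (star ψ ⬝ᵥ ψ).re with hNdef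
  set A : ℝ := (star ψ ⬝ᵥ F.hamiltonian *ᵥ ψ).re with hAdef
  set M : ℝ := (star ψ ⬝ᵥ (F.hamiltonian * F.hamiltonian) *ᵥ ψ).re with hMdef
  have hs0 : 0 ≤ s := le_trans (re_star_dotProduct_self_nonneg _) hs
  have hLE : L' ≤ E := hL.2
  have hstar : 0 ≤ M - (E + β') * A + E * β' * N + s / 8 * (β' - E) ^ 2 :=
    singletEnergy_temple_spin_ineq hF hG hψ hs
  by_contra hlt
  push Not at hlt
  -- `P` as `α e² + γ e + δ`
  have hform : ∀ e : ℝ, M - (e + β') * A + e * β' * N + s / 8 * (β' - e) ^ 2 =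
      (s / 8) * e ^ 2 + (β' * N - A - s * β' / 4) * e + (M - β' * A + s * β' ^ 2 / 8) :=
    fun e => by ring
  have h1 : (s / 8) * L' ^ 2 + (β' * N - A - s * β' / 4) * L' + (M - β' * A + s * β' ^ 2 / 8) < 0 := by
    rw [← hform]; exact hPL
  have h2 : (s / 8) * lo' ^ 2 + (β' * N - A - s * β' / 4) * lo' + (M - β' * A + s * β' ^ 2 / 8) ≤ 0 := by
    rw [← hform]; exact hPlo
  have h3 := convexQuadratic_neg_of_endpoints (div_nonneg hs0 (by norm_num)) hLE hlt h1 h2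
  rw [← hform] at h3
  linarith

/-- The same under the codimension-one gap certificate `SingletGapCertificateCodimOne F n β` (downgrade
first). [cite: ReedSimonIV1978, Thm XIII.5] -/
theorem singletLowerRow_of_temple_spin_codimOne {F : Model k} (hF : F.IsSymmetric) {n : ℕ} {β L lo : ℚ}
    (hG : SingletGapCertificateCodimOne F n β) (hL : SingletLowerRow F n L)
    {ψ : Fock (Orb (Fin k))} (hψ : IsInSector n n ψ) {s : ℝ}
    (hs : (star (spinPlus *ᵥ ψ) ⬝ᵥ (spinPlus *ᵥ ψ)).re ≤ s)
    (hPL : (star ψ ⬝ᵥ (F.hamiltonian * F.hamiltonian) *ᵥ ψ).re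
        - (((L : ℚ) : ℝ) + ((β : ℚ) : ℝ)) * (star ψ ⬝ᵥ F.hamiltonian *ᵥ ψ).re
        + ((L : ℚ) : ℝ) * ((β : ℚ) : ℝ) * (star ψ ⬝ᵥ ψ).re
        + s / 8 * (((β : ℚ) : ℝ) - ((L : ℚ) : ℝ)) ^ 2 < 0)
    (hPlo : (star ψ ⬝ᵥ (F.hamiltonian * F.hamiltonian) *ᵥ ψ).re
        - (((lo : ℚ) : ℝ) + ((β : ℚ) : ℝ)) * (star ψ ⬝ᵥ F.hamiltonian *ᵥ ψ).re
        + ((lo : ℚ) : ℝ) * ((β : ℚ) : ℝ) * (star ψ ⬝ᵥ ψ).re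
        + s / 8 * (((β : ℚ) : ℝ) - ((lo : ℚ) : ℝ)) ^ 2 ≤ 0) :
    SingletLowerRow F n lo :=
  singletLowerRow_of_temple_spin hF (hG.singletGapCertificate hF) hL hψ hs hPL hPlo

/-! ## §4 The claim-node shape and its soundness -/

/-- **SINGLET TEMPLE CERTIFICATE FROM A SPIN-CONTAMINATED STATE** (claim-node SHAPE; nothing asserted):
for given rationals `L` (an a-priori singlet lower row, certified SEPARATELY), `lo` (the claim) and `β`
(the `K`-gap point, certified SEPARATELY), an explicit vector `ψ` of the `(n, n)` sector and a real `s`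
with `‖Ŝ_+ψ‖² ≤ s` such that the polynomial `P(e) = Re⟨ψ,Ĥ²ψ⟩ − (e + β)Re⟨ψ,Ĥψ⟩ + eβ⟨ψ,ψ⟩ + (s/8)(β − e)²`
of (★) satisfies `P(L) < 0` and `P(lo) ≤ 0`. The numerical content (the exact moments of the SAME `ψ`, or
their enclosures — `Rows/SingletTempleSpinIntervalRows.lean`) is established outside the kernel by the
cell's readers, exactly as for `SingletTempleCertificate` / `SingletUpperCertificateSpin`.
[cite: ReedSimonIV1978, Thm XIII.5] -/
def SingletTempleCertificateSpin (F : Model k) (n : ℕ) (L lo β : ℚ) : Prop :=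
  ∃ (ψ : Fock (Orb (Fin k))) (s : ℝ), IsInSector n n ψ ∧
    (star (spinPlus *ᵥ ψ) ⬝ᵥ (spinPlus *ᵥ ψ)).re ≤ s ∧
    (star ψ ⬝ᵥ (F.hamiltonian * F.hamiltonian) *ᵥ ψ).re
        - (((L : ℚ) : ℝ) + ((β : ℚ) : ℝ)) * (star ψ ⬝ᵥ F.hamiltonian *ᵥ ψ).re
        + ((L : ℚ) : ℝ) * ((β : ℚ) : ℝ) * (star ψ ⬝ᵥ ψ).re
        + s / 8 * (((β : ℚ) : ℝ) - ((L : ℚ) : ℝ)) ^ 2 < 0 ∧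
    (star ψ ⬝ᵥ (F.hamiltonian * F.hamiltonian) *ᵥ ψ).re
        - (((lo : ℚ) : ℝ) + ((β : ℚ) : ℝ)) * (star ψ ⬝ᵥ F.hamiltonian *ᵥ ψ).re
        + ((lo : ℚ) : ℝ) * ((β : ℚ) : ℝ) * (star ψ ⬝ᵥ ψ).re
        + s / 8 * (((β : ℚ) : ℝ) - ((lo : ℚ) : ℝ)) ^ 2 ≤ 0

/-- **SOUNDNESS**: the codimension-one gap leg on `K` at `β`, an a-priori singlet lower row at `L`,
and a spin-contaminated Temple certificate give the SINGLET lower row `lo ≤ E₀(Ĥ_F; N = 2n, S = 0)`.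
[cite: ReedSimonIV1978, Thm XIII.5] -/
theorem singletLowerRow_of_templeSpinCertificate {F : Model k} (hF : F.IsSymmetric) {n : ℕ}
    {β L lo : ℚ} (hG : SingletGapCertificateCodimOne F n β) (hL : SingletLowerRow F n L)
    (h : SingletTempleCertificateSpin F n L lo β) : SingletLowerRow F n lo := by
  obtain ⟨ψ, s, hψ, hs, hPL, hPlo⟩ := h
  exact singletLowerRow_of_temple_spin_codimOne hF hG hL hψ hs hPL hPlo

/-- The same with the a-priori row supplied by a SECTOR lower row `LowerRow F n n L` (any certified leg on
the `(n, n)` sector of the same file — `K ⊆ sector`, `LowerRow.singlet`). [cite: ReedSimonIV1978, Thm XIII.5] -/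
theorem singletLowerRow_of_templeSpinCertificate_of_lowerRow {F : Model k} (hF : F.IsSymmetric) {n : ℕ}
    {β L lo : ℚ} (hG : SingletGapCertificateCodimOne F n β) (hL : LowerRow F n n L)
    (h : SingletTempleCertificateSpin F n L lo β) : SingletLowerRow F n lo :=
  singletLowerRow_of_templeSpinCertificate hF hG (hL.singlet hF) h

end Summit.Ventures.CertifiedQuantumChemistry

end
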